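import Mathlib
import Summits.CriticalPhenomena.CardyFormulaZ2.Theorems.CardySelfRefinementDefs
import Summits.CriticalPhenomena.CardyFormulaZ2.Theorems.CardySelfRefinementGradientComparabilityStubSlopeBoundsCornerSDAssembly
import Summits.CriticalPhenomena.CardyFormulaZ2.Theorems.CardySelfRefinementGradientComparabilityStubSlopeBoundsCornerTransfer3
import Summits.CriticalPhenomena.CardyFormulaZ2.Theorems.CardySelfRefinementGradientComparabilityStubSlopeBoundsCorner
import HarnessLib

/-!
# Crux `GradientComparability` (stmt-CriticalPhenomena-10269), line `monotone-product-coordinates` —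
# stub `stub_cornerLocalSlope` (LOC): the signed domination (SD) for `k = 3` modulo the boundary
# layer — assembly of the penalty half and the `k = 3` corner transfer

Route `CardySelfRefinement`, sub-problem `CriticalPhenomena/CardyFormulaZ2`; vocabulary from
`CardySelfRefinementDefs` (`ax tb M Aloc window coinWindow coinsOf edgeOf P Dρ Dc`); the penalty half
`Drho_add_mul_Dc_ge_of_far` (`…StubSlopeBoundsCornerPenaltyHalf`), the summed `k = 3` corner transfer
`sum_real_isPivotal_interior_le_three` (`…StubSlopeBoundsCornerTransfer3`), Russo's formula
`stub_Dc_eq_sum_pivotal`, and `real_setPivotal_eq_zero_of_notMem_coinWindow` of the `k = 2` twin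
`…StubSlopeBoundsCornerSDAssembly` (`cornerSignedDomination_two_of_layerTerms`).

## Mathematics

Fix `k = 3`, a quad family `F` (`0 < m`), a mesh `η > 0` and a parameter point `(ρ, c)`,
`ρ ∈ [0,1]`, `0 ≤ c ≤ 1/30`.  Let `K` be the coin window, `Sel ⊆ K` its selector coins, and for radii
`r, r'` with `20η ≤ r`, `r + 9η ≤ r'`:
* `S ⊆ Sel` the FAR selectors (both interior bundle vertices drawn `r`-far from every side of every
  quad), `N_S = Σ_{i ∈ S} M(PIV_i)`, `PIV_i = {ω ∪ B_i ∈ Aloc ∧ ω ∖ B_i ∉ Aloc}`, and `N_L` the same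
  sum over the LAYER selectors `Sel ∖ S`;
* `VD` the labels `vd` (`edgeOf vd ∈ window`, `¬ ax 3 vd`) of the non-axial window edges, split into
  the FAR labels (both ends drawn `r'`-far) and the LAYER labels `VL`; `D_far`, `D_L` the sums of
  `M(edgeOf vd pivotal)` over them, so that `∂cP = D_far + D_L` (Russo, `stub_Dc_eq_sum_pivotal`).

The two landed halves of (SD) read
(P) `(3/8 − (7/2)·c/(1−c))·N_S − (3/8)·N_L ≤ ∂ρP + 28c·∂cP` (`Drho_add_mul_Dc_ge_of_far`, `k = 3`),
(T) `D_far ≤ 314568/(1−c) · N_{S'}` (`sum_real_isPivotal_interior_le_three`), `S'` the side selectors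
of the cells of the far labels.  Bookkeeping: a side selector of a far cell is either outside the
coin window — then `M(PIV_i) = 0` (`real_setPivotal_eq_zero_of_notMem_coinWindow`) — or a far
selector: its two interior bundle vertices are drawn within `5√2 η ≤ 9η` of the end `vd.1` of the
far label (`far_side_of_far_endpoint_three`); hence `N_{S'} ≤ N_S`.
**Layer hypothesis (LAYER₃)**: on the corner level band, for some `θ < 1` chosen with `δ, c₁`
before the levels, `N_L + D_L ≤ θ · N_S` for suitable radii `20η ≤ r`, `r + 9η ≤ r'` (half-plane
three-arm summability of the boundary layer — NOT proved here).  Then (algebra,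
`signedDomination_three_algebra`): for `c ≤ c₁' = min c₁ ((1−θ)/30)`,
`∂ρP + 28c·∂cP ≥ (1−θ)/4 · N_S ≥ (1−θ)/1400000 · ∂cP`, i.e. the signed domination (SD)
`a ∂cP ≤ ∂ρP + B c ∂cP` with `a = (1−θ)/1400000`, `B = 28`, `δ' = min δ ½` — the hypothesis `hSD`
of `cornerLocalSlope_of_signedDomination` for `k = 3` (`cornerSignedDomination_three_of_layerTerms`,
registered).
-/

noncomputable section

namespace Summit.CriticalPhenomena.CardyFormulaZ2.Theorems.CardySelfRefinement

open scoped Topology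
open Filter Set MeasureTheory
open Literature.Probability.LatticeModels Literature.Probability.Percolation
open Literature.Probability.Percolation.QuadCrossing
open Summit.CriticalPhenomena.CardyFormulaZ2.Theses.CardySelfRefinement


/-! ## Drawn distances inside a cell -/

/-- Two sites at sup-distance `≤ 3` are drawn, at mesh `η`, within `9|η|` of each other
(`z = √2 · (x₀ + i x₁)`, `√2 · 6 ≤ 9`). -/
theorem dist_z_le_nine_mul_abs (x y : Site 2) (h0 : |x 0 - y 0| ≤ 3) (h1 : |x 1 - y 1| ≤ 3) (η : ℝ) :
    dist ((η : ℂ) * squareLatticeEmbedding.z x) ((η : ℂ) * squareLatticeEmbedding.z y) ≤ 9 * |η| := by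
  -- adapted from `dist_z_le_six_mul_abs` (…StubSlopeBoundsCornerSDAssembly)
  rw [dist_eq_norm, ← mul_sub, norm_mul, Complex.norm_real, Real.norm_eq_abs]
  have hz : squareLatticeEmbedding.z x - squareLatticeEmbedding.z y =
      ((Real.sqrt 2 : ℝ) : ℂ) * (Site.toComplex x - Site.toComplex y) := by
    show ((Real.sqrt 2 : ℝ) : ℂ) * Site.toComplex x - ((Real.sqrt 2 : ℝ) : ℂ) * Site.toComplex y = _
    ring
  rw [hz, norm_mul, Complex.norm_real, Real.norm_of_nonneg (Real.sqrt_nonneg _)]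
  have hre : (Site.toComplex x - Site.toComplex y).re = (x 0 : ℝ) - y 0 := by simp [Site.toComplex]
  have him : (Site.toComplex x - Site.toComplex y).im = (x 1 : ℝ) - y 1 := by simp [Site.toComplex]
  have h0' : |((x 0 : ℤ) : ℝ) - y 0| ≤ 3 := by exact_mod_cast h0
  have h1' : |((x 1 : ℤ) : ℝ) - y 1| ≤ 3 := by exact_mod_cast h1
  have hn : ‖Site.toComplex x - Site.toComplex y‖ ≤ 6 :=
    calc ‖Site.toComplex x - Site.toComplex y‖
        ≤ |(Site.toComplex x - Site.toComplex y).re| + |(Site.toComplex x - Site.toComplex y).im| :=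
          Complex.norm_le_abs_re_add_abs_im _
      _ ≤ 6 := by rw [hre, him]; linarith
  have hs : Real.sqrt 2 ≤ 3 / 2 := by
    nlinarith [Real.sq_sqrt (show (0 : ℝ) ≤ 2 by norm_num), Real.sqrt_nonneg 2]
  calc |η| * (Real.sqrt 2 * ‖Site.toComplex x - Site.toComplex y‖) ≤ |η| * (3 / 2 * 6) :=
        mul_le_mul_of_nonneg_left (mul_le_mul hs hn (norm_nonneg _) (by norm_num)) (abs_nonneg η)
    _ = 9 * |η| := by ring

/-- **A side selector of a far cell is far, `k = 3`.**  For a label `vd` whose end `vd.1` is drawn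
`r'`-far from every side of every quad, the two interior vertices of each of the four side bundles
`(z,0)`, `(z+e₀,1)`, `(z+e₁,0)`, `(z,1)` of its cell `z = tb 3 vd` are drawn `r`-far whenever
`r + 9η ≤ r'` (they are at sup-distance `≤ 3` from `vd.1 ∈ 3z + {0,1,2}²`); stated as the far
predicate of `Drho_add_mul_Dc_ge_of_far` for the selector coin `i`. -/
theorem far_side_of_far_endpoint_three {k : ℕ} (hk : k = 3) {m : ℕ} (F : Fin m → Quad (Set.univ : Set ℂ))
    {η r r' : ℝ} (hη : 0 < η) (hrr' : r + 9 * η ≤ r') (vd : Site 2 × Fin 2)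
    (hfar : ∀ (a : Fin m) (b : Fin 4), ∀ p ∈ (F a).side b, r' ≤ dist ((η : ℂ) * squareLatticeEmbedding.z vd.1) p)
    (i : Site 2 × Fin 2 × Fin 3)
    (hi : i = (tb k vd, (0 : Fin 2), (2 : Fin 3)) ∨ i = (tb k vd + Pi.single 0 1, (1 : Fin 2), (2 : Fin 3)) ∨
      i = (tb k vd + Pi.single 1 1, (0 : Fin 2), (2 : Fin 3)) ∨ i = (tb k vd, (1 : Fin 2), (2 : Fin 3))) :
    ∀ j : ℕ, 0 < j → j < k → ∀ (a : Fin m) (b : Fin 4), ∀ p ∈ (F a).side b,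
      r ≤ dist ((η : ℂ) * squareLatticeEmbedding.z (fun l => (k : ℤ) * i.1 l + if l = i.2.1 then (j : ℤ) else 0)) p := by
  intro j hj0 hjk a b p hp
  subst hk
  set w : Site 2 := fun l => ((3 : ℕ) : ℤ) * i.1 l + if l = i.2.1 then (j : ℤ) else 0 with hw
  have h0 : |vd.1 0 - w 0| ≤ 3 := by
    rw [abs_le]
    rcases hi with rfl | rfl | rfl | rfl <;> simp [hw, tb, Pi.single_apply] <;> omega
  have h1 : |vd.1 1 - w 1| ≤ 3 := by
    rw [abs_le]
    rcases hi with rfl | rfl | rfl | rfl <;> simp [hw, tb, Pi.single_apply] <;> omega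
  have hd := dist_z_le_nine_mul_abs vd.1 w h0 h1 η
  rw [abs_of_pos hη] at hd
  have hx := hfar a b p hp
  have htri := dist_triangle ((η : ℂ) * squareLatticeEmbedding.z vd.1) ((η : ℂ) * squareLatticeEmbedding.z w) p
  linarith

/-! ## The algebra of the assembly -/

/-- **The algebra of the (SD) assembly for `k = 3`.**  With `N_S, N_L, D_L ≥ 0`,
`∂cP = D_far + D_L`, `0 ≤ θ < 1`, `0 ≤ c ≤ (1−θ)/30`: the penalty half (P)
(`(3/8 − (7/2)c/(1−c))·N_S − (3/8)·N_L ≤ ∂ρP + 28c·∂cP`), the transfer (T)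
`D_far ≤ 314568/(1−c) N_{S'}`, `N_{S'} ≤ N_S` and the layer bound `N_L + D_L ≤ θ N_S` give
`(1−θ)/1400000 · ∂cP ≤ ∂ρP + 28 c ∂cP` (`c/(1−c) ≤ (1−θ)/29`, `314568/(1−c) ≤ 325416`,
`∂cP ≤ 325417 N_S`, `∂ρP + 28c ∂cP ≥ (1−θ)/4 · N_S`). -/
theorem signedDomination_three_algebra {k : ℕ} (hk : k = 3) {θ c NS NL NS' DF DL Dr D : ℝ}
    (hθ0 : 0 ≤ θ) (hθ : θ < 1) (hc0 : 0 ≤ c) (hc : c ≤ (1 - θ) / 30)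
    (hNS : 0 ≤ NS) (hNL : 0 ≤ NL) (hDL : 0 ≤ DL)
    (hpen : (1 / 2 - (1 / 2) ^ k - c / (1 - c) * ((1 / 2) ^ k * (2 * ((k : ℝ) - 1) * (2 ^ k - 1)))) * NS -
        (1 / 2 - (1 / 2) ^ k) * NL ≤ Dr + c * ((1 / 2) ^ k * (2 ^ (k + 2) * (2 ^ k - 1))) * D)
    (htr : DF ≤ 314568 / (1 - c) * NS') (hS : NS' ≤ NS) (hL : NL + DL ≤ θ * NS) (hD : D = DF + DL) :
    (1 - θ) / 1400000 * D ≤ Dr + 28 * c * D := by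
  subst hk
  have hc30 : c ≤ 1 / 30 := hc.trans (by linarith)
  have h1c : 0 < 1 - c := by linarith
  have hq : c / (1 - c) ≤ (1 - θ) / 29 := by
    rw [div_le_iff₀ h1c]
    have h30 : 30 * c ≤ 1 - θ := by linarith [(le_div_iff₀ (by norm_num : (0 : ℝ) < 30)).1 hc]
    nlinarith [mul_nonneg hθ0 hc0]
  have hβ : 314568 / (1 - c) ≤ 325416 := by
    rw [div_le_iff₀ h1c]
    linarith
  have h1 : c / (1 - c) * NS ≤ (1 - θ) / 29 * NS := mul_le_mul_of_nonneg_right hq hNS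
  have h2 : 314568 / (1 - c) * NS' ≤ 325416 * NS :=
    (mul_le_mul_of_nonneg_left hS (by positivity)).trans (mul_le_mul_of_nonneg_right hβ hNS)
  have hθNS : 0 ≤ (1 - θ) * NS := mul_nonneg (sub_nonneg.2 hθ.le) hNS
  have hD' : D ≤ 325417 * NS := by nlinarith
  have hθD := mul_le_mul_of_nonneg_left hD' (sub_nonneg.2 hθ.le)
  norm_num at hpen
  nlinarith

/-! ## (SD) for `k = 3` from the layer hypothesis (LAYER₃) -/

/-- **Signed domination (SD) for `k = 3` modulo the boundary layer** (registered helper of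
`stub_cornerLocalSlope`, line `monotone-product-coordinates`).
HYPOTHESIS (LAYER₃): for `k = 3` and a nonempty quad family there are `δ, c₁ > 0` and `θ < 1` such
that for all levels `0 < vlo < vhi < 1` and all small meshes, at every band point (`ρ ∈ [1−2δ, 1]`,
`c ∈ [0, c₁]`, `P ∈ [vlo, vhi]`) there are radii `r, r'` with `20η ≤ r`, `r + 9η ≤ r'` such that, with
`K` the coin window, `S` the selector coins of `K` whose bundle interior vertices are drawn `r`-far
from every side of every quad, and `VL` the labels of the non-axial window edges having an end within
`r'` of some side:  `N_{Sel ∖ S} + Σ_{vd ∈ VL} M(edgeOf vd pivotal) ≤ θ · N_S`,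
`N_T = Σ_{i ∈ T} M(PIV_i)`, `PIV_i = {ω ∪ B_i ∈ Aloc ∧ ω ∖ B_i ∉ Aloc}` (the boundary layer carries
less pivotality than the far bundles — the corner twin of `axialLayer_pivotal_le`, open).
CONCLUSION: the signed domination inequality `a · ∂cP ≤ ∂ρP + B · c · ∂cP` on the band `ρ ∈ [1−2δ', 1]`,
`c ∈ [0, c₁']` for `k = 3`, with `δ' = min δ ½`, `a = (1 − max θ 0)/1400000`, `B = 28`,
`c₁' = min c₁ ((1 − max θ 0)/30)` and the `η₀` of (LAYER₃) — by the penalty half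
`Drho_add_mul_Dc_ge_of_far` (`k = 3`: `(3/8 − (7/2)c/(1−c))·N_S − (3/8)·N_L ≤ ∂ρP + 28c·∂cP`), Russo
`stub_Dc_eq_sum_pivotal` split far/layer, the corner transfer `sum_real_isPivotal_interior_le_three`
with `S'` the side selectors of the far cells, `N_{S'} ≤ N_S`
(`real_setPivotal_eq_zero_of_notMem_coinWindow`, `far_side_of_far_endpoint_three`) and
`signedDomination_three_algebra`.  USE: for `hL : (LAYER₃)` and `0 < m`,
`cornerLocalSlope_of_signedDomination 3 m F (cornerSignedDomination_three_of_layerTerms hL 3 rfl m F hm)`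
is (LOC) = `stub_cornerLocalSlope` at `k = 3`. -/
theorem cornerSignedDomination_three_of_layerTerms : (∀ k : ℕ, k = 3 → ∀ (m : ℕ) (F : Fin m → Quad (Set.univ : Set ℂ)), 0 < m → ∃ δ c₁ θ : ℝ, 0 < δ ∧ 0 < c₁ ∧ θ < 1 ∧ ∀ vlo vhi : ℝ, 0 < vlo → vlo < vhi → vhi < 1 → ∃ η₀ : ℝ, 0 < η₀ ∧ ∀ η ∈ Set.Ioo 0 η₀, ∀ ρ ∈ Set.Icc (1 - 2 * δ) 1, ∀ c ∈ Set.Icc (0 : ℝ) c₁, P k m F η ρ c ∈ Set.Icc vlo vhi → ∃ r r' : ℝ, 20 * η ≤ r ∧ r + 9 * η ≤ r' ∧ ∀ (K S : Finset (Site 2 × Fin 2 × Fin 3)), (↑K : Set (Site 2 × Fin 2 × Fin 3)) = coinWindow k (window m F η) → (∀ i, i ∈ S ↔ i ∈ K ∧ i.2.2 = 2 ∧ ∀ j : ℕ, 0 < j → j < k → ∀ (a : Fin m) (b : Fin 4), ∀ p ∈ (F a).side b, r ≤ dist ((η : ℂ) * squareLatticeEmbedding.z (fun l => (k : ℤ)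 * i.1 l + if l = i.2.1 then (j : ℤ) else 0)) p) → ∀ VL : Finset (Site 2 × Fin 2), (∀ vd, vd ∈ VL ↔ (edgeOf vd ∈ window m F η ∧ ¬ ax k vd) ∧ ∃ x ∈ edgeOf vd, ∃ (a : Fin m) (b : Fin 4), ∃ p ∈ (F a).side b, dist ((η : ℂ) * squareLatticeEmbedding.z x) p < r') → ∑ i ∈ K.filter (fun i => i.2.2 = 2) \ S, (M k ρ c).real {ω | ω ∪ edgeOf '' {vd : Site 2 × Fin 2 | ax k vd ∧ tb k vd = i.1 ∧ vd.2 = i.2.1} ∈ Aloc m F η ∧ ω \ edgeOf '' {vd : Site 2 × Fin 2 | ax k vd ∧ tb k vd = i.1 ∧ vd.2 = i.2.1} ∉ Aloc m F η} + ∑ vd ∈ VL, (M k ρ c).real {ω | IsPivotal (Aloc m F η) (edgeOf vd) ω} ≤ θ * ∑ i ∈ S, (M k ρ c).real {ω | ω ∪ edgeOf '' {vd : Site 2 × Fin 2 | ax k vd ∧ tb k vd = i.1 ∧ vd.2 = i.2.1} ∈ Aloc m F η ∧ ω \ edgeOf '' {vd : Site 2 × Fin 2 | ax k vd ∧ tb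 k vd = i.1 ∧ vd.2 = i.2.1} ∉ Aloc m F η}) → ∀ k : ℕ, k = 3 → ∀ (m : ℕ) (F : Fin m → Quad (Set.univ : Set ℂ)), 0 < m → ∃ δ a B c₁ : ℝ, 0 < δ ∧ 0 < a ∧ 0 < c₁ ∧ ∀ vlo vhi : ℝ, 0 < vlo → vlo < vhi → vhi < 1 → ∃ η₀ : ℝ, 0 < η₀ ∧ ∀ η ∈ Set.Ioo 0 η₀, ∀ ρ ∈ Set.Icc (1 - 2 * δ) 1, ∀ c ∈ Set.Icc (0 : ℝ) c₁, P k m F η ρ c ∈ Set.Icc vlo vhi → a * Dc k m F η (ρ, c) ≤ Dρ k m F η (ρ, c) + B * c * Dc k m F η (ρ, c) := by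
  intro hL k hk m F hm
  obtain ⟨δ, c₁, θ, hδ, hc₁, hθ, hL1⟩ := hL k hk m F hm
  have hk0 : 0 < k := by omega
  -- the constants
  set θ' : ℝ := max θ 0 with hθ'
  have hθ'0 : 0 ≤ θ' := le_max_right _ _
  have hθ'1 : θ' < 1 := max_lt hθ one_pos
  refine ⟨min δ (1 / 2), (1 - θ') / 1400000, 28, min c₁ ((1 - θ') / 30), lt_min hδ (by norm_num),
    by linarith, lt_min hc₁ (by linarith), fun vlo vhi hvlo hlt hvhi => ?_⟩
  obtain ⟨η₀, hη₀, hL2⟩ := hL1 vlo vhi hvlo hlt hvhi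
  refine ⟨η₀, hη₀, fun η hη ρ hρ c hc hP => ?_⟩
  have hρ' : ρ ∈ Set.Icc (1 - 2 * δ) 1 := ⟨by linarith [hρ.1, min_le_left δ (1 / 2)], hρ.2⟩
  have hρ01 : ρ ∈ Set.Icc (0 : ℝ) 1 := ⟨by linarith [hρ.1, min_le_right δ (1 / 2)], hρ.2⟩
  have hcc₁ : c ∈ Set.Icc (0 : ℝ) c₁ := ⟨hc.1, hc.2.trans (min_le_left _ _)⟩
  have hcθ : c ≤ (1 - θ') / 30 := hc.2.trans (min_le_right _ _)
  have hcIco : c ∈ Set.Ico (0 : ℝ) 1 := ⟨hc.1, by linarith⟩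
  obtain ⟨r, r', hr, hr', hL3⟩ := hL2 η hη ρ hρ' c hcc₁ hP
  classical
  -- the coin window, the far selectors, the labels of the non-axial window edges, far and layer
  obtain ⟨K, hK⟩ := exists_coinFinset k m F hη.1.ne'
  set far : Site 2 × Fin 2 × Fin 3 → Prop := fun i => ∀ j : ℕ, 0 < j → j < k → ∀ (a : Fin m) (b : Fin 4),
    ∀ p ∈ (F a).side b, r ≤ dist ((η : ℂ) * squareLatticeEmbedding.z
      (fun l => (k : ℤ) * i.1 l + if l = i.2.1 then (j : ℤ) else 0)) p with hfar_def
  set S : Finset (Site 2 × Fin 2 × Fin 3) := (K.filter (fun i => i.2.2 = 2)).filter far with hS_def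
  have hS : ∀ i, i ∈ S ↔ i ∈ K ∧ i.2.2 = 2 ∧ far i := fun i => by
    simp only [hS_def, Finset.mem_filter, and_assoc]
  have hSsub : S ⊆ K.filter (fun i => i.2.2 = 2) := Finset.filter_subset _ _
  have hfinVD : (edgeOf ⁻¹' window m F η).Finite :=
    (window_finite m F hη.1.ne').preimage edgeOf_injective.injOn
  set VD : Finset (Site 2 × Fin 2) := hfinVD.toFinset.filter (fun vd => ¬ ax k vd) with hVD_def
  have hVD : ∀ vd, vd ∈ VD ↔ edgeOf vd ∈ window m F η ∧ ¬ ax k vd := fun vd => by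
    simp only [hVD_def, Finset.mem_filter, Set.Finite.mem_toFinset, Set.mem_preimage]
  set far' : Site 2 × Fin 2 → Prop := fun vd => ∀ x ∈ edgeOf vd, ∀ (a : Fin m) (b : Fin 4),
    ∀ p ∈ (F a).side b, r' ≤ dist ((η : ℂ) * squareLatticeEmbedding.z x) p with hfar'_def
  set VF : Finset (Site 2 × Fin 2) := VD.filter far' with hVF_def
  set VL : Finset (Site 2 × Fin 2) := VD.filter (fun vd => ¬ far' vd) with hVL_def
  have hVL : ∀ vd, vd ∈ VL ↔ (edgeOf vd ∈ window m F η ∧ ¬ ax k vd) ∧ ∃ x ∈ edgeOf vd,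
      ∃ (a : Fin m) (b : Fin 4), ∃ p ∈ (F a).side b, dist ((η : ℂ) * squareLatticeEmbedding.z x) p < r' := by
    intro vd
    rw [hVL_def, Finset.mem_filter, hVD]
    refine and_congr_right fun _ => ?_
    simp only [hfar'_def, not_forall, not_le, exists_prop]
  have hVF : ∀ vd ∈ VF, ¬ ax k vd ∧ ∀ x ∈ edgeOf vd, ∀ (a : Fin m) (b : Fin 4), ∀ p ∈ (F a).side b,
      r' ≤ dist ((η : ℂ) * squareLatticeEmbedding.z x) p := fun vd hvd =>
    ⟨((hVD vd).1 (Finset.mem_filter.1 hvd).1).2, (Finset.mem_filter.1 hvd).2⟩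
  -- the currencies
  set g : Site 2 × Fin 2 × Fin 3 → ℝ := fun i => (M k ρ c).real {ω | ω ∪ edgeOf '' {vd : Site 2 × Fin 2 |
    ax k vd ∧ tb k vd = i.1 ∧ vd.2 = i.2.1} ∈ Aloc m F η ∧ ω \ edgeOf '' {vd : Site 2 × Fin 2 |
    ax k vd ∧ tb k vd = i.1 ∧ vd.2 = i.2.1} ∉ Aloc m F η} with hg
  set piv : Site 2 × Fin 2 → ℝ := fun vd => (M k ρ c).real {ω | IsPivotal (Aloc m F η) (edgeOf vd) ω} with hpiv
  have hg0 : ∀ i, 0 ≤ g i := fun i => measureReal_nonneg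
  have hpiv0 : ∀ vd, 0 ≤ piv vd := fun vd => measureReal_nonneg
  -- (LAYER₃)
  have hlayer : ∑ i ∈ K.filter (fun i => i.2.2 = 2) \ S, g i + ∑ vd ∈ VL, piv vd ≤ θ * ∑ i ∈ S, g i :=
    hL3 K S hK hS VL hVL
  -- the penalty half (P)
  have hpen : (1 / 2 - (1 / 2) ^ k - c / (1 - c) * ((1 / 2) ^ k * (2 * ((k : ℝ) - 1) * (2 ^ k - 1)))) * ∑ i ∈ S, g i -
      (1 / 2 - (1 / 2) ^ k) * ∑ i ∈ K.filter (fun i => i.2.2 = 2) \ S, g i ≤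
        Dρ k m F η (ρ, c) + c * ((1 / 2) ^ k * (2 ^ (k + 2) * (2 ^ k - 1))) * Dc k m F η (ρ, c) :=
    Drho_add_mul_Dc_ge_of_far k m hk0 F η r hη.1 (by linarith [hη.1]) ρ c hρ01 hcIco K hK S hSsub
      fun i hi => ((hS i).1 hi).2.2
  -- Russo for `∂cP`, split far / layer
  have hW : ∀ e, e ∈ VD.image edgeOf ↔ e ∈ window m F η ∧ ∃ (v : Site 2) (d : Fin 2), e = edgeOf (v, d) ∧ ¬ ax k (v, d) := by
    intro e
    simp only [Finset.mem_image, hVD]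
    constructor
    · rintro ⟨⟨v, d⟩, ⟨hw, hax⟩, rfl⟩
      exact ⟨hw, v, d, rfl, hax⟩
    · rintro ⟨hw, v, d, rfl, hax⟩
      exact ⟨(v, d), ⟨hw, hax⟩, rfl⟩
  have hDc : Dc k m F η (ρ, c) = ∑ vd ∈ VF, piv vd + ∑ vd ∈ VL, piv vd := by
    rw [stub_Dc_eq_sum_pivotal k m F hη.1.ne' ρ ⟨hc.1, hcIco.2.le⟩ (VD.image edgeOf) hW,
      Finset.sum_image fun x _ y _ h => edgeOf_injective h]
    exact (Finset.sum_filter_add_sum_filter_not VD far' piv).symm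
  -- the corner transfer (T) with `S'` the side selectors of the far cells
  set τ : Site 2 × Fin 2 → Finset (Site 2 × Fin 2 × Fin 3) := fun vd =>
    {(tb k vd, (0 : Fin 2), (2 : Fin 3)), (tb k vd + Pi.single 0 1, (1 : Fin 2), (2 : Fin 3)),
      (tb k vd + Pi.single 1 1, (0 : Fin 2), (2 : Fin 3)), (tb k vd, (1 : Fin 2), (2 : Fin 3))} with hτ
  set S' : Finset (Site 2 × Fin 2 × Fin 3) := VF.biUnion τ with hS'_def
  have hτmem : ∀ vd i, i ∈ τ vd ↔ i = (tb k vd, (0 : Fin 2), (2 : Fin 3)) ∨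
      i = (tb k vd + Pi.single 0 1, (1 : Fin 2), (2 : Fin 3)) ∨
      i = (tb k vd + Pi.single 1 1, (0 : Fin 2), (2 : Fin 3)) ∨ i = (tb k vd, (1 : Fin 2), (2 : Fin 3)) := by
    intro vd i
    simp only [hτ, Finset.mem_insert, Finset.mem_singleton]
  have hS'mem : ∀ vd ∈ VF, (tb k vd, (0 : Fin 2), (2 : Fin 3)) ∈ S' ∧
      (tb k vd + Pi.single 0 1, (1 : Fin 2), (2 : Fin 3)) ∈ S' ∧
      (tb k vd + Pi.single 1 1, (0 : Fin 2), (2 : Fin 3)) ∈ S' ∧ (tb k vd, (1 : Fin 2), (2 : Fin 3)) ∈ S' := by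
    intro vd hvd
    refine ⟨?_, ?_, ?_, ?_⟩ <;> exact Finset.mem_biUnion.2 ⟨vd, hvd, (hτmem vd _).2 (by simp)⟩
  have htr : ∑ vd ∈ VF, piv vd ≤ 314568 / (1 - c) * ∑ i ∈ S', g i :=
    sum_real_isPivotal_interior_le_three k m hk F η r' hη.1 (by linarith [hη.1]) ρ c hcIco VF hVF S' hS'mem
  -- `N_{S'} ≤ N_S`
  have hside : ∀ i ∈ S', far i ∧ (i ∈ K → i.2.2 = 2) ∧ (i ∉ K → g i = 0) := by
    intro i hi
    obtain ⟨vd, hvd, hi⟩ := Finset.mem_biUnion.1 hi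
    have hi' := (hτmem vd i).1 hi
    have hfarvd : ∀ (a : Fin m) (b : Fin 4), ∀ p ∈ (F a).side b,
        r' ≤ dist ((η : ℂ) * squareLatticeEmbedding.z vd.1) p :=
      fun a b p hp => (hVF vd hvd).2 vd.1 (Sym2.mem_mk_left _ _) a b p hp
    refine ⟨far_side_of_far_endpoint_three hk F hη.1 hr' vd hfarvd i hi', ?_, fun hiK => ?_⟩
    · intro _
      rcases hi' with rfl | rfl | rfl | rfl <;> rfl
    · have hiW : i ∉ coinWindow k (window m F η) := fun hmem => hiK (by rw [← Finset.mem_coe, hK]; exact hmem)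
      rcases hi' with rfl | rfl | rfl | rfl <;>
        exact real_setPivotal_eq_zero_of_notMem_coinWindow k m F η ρ c _ _ hiW
  have hS'S : ∑ i ∈ S', g i ≤ ∑ i ∈ S, g i := by
    calc ∑ i ∈ S', g i = ∑ i ∈ S'.filter (fun i => i ∈ K), g i := by
          rw [Finset.sum_filter]
          refine Finset.sum_congr rfl fun i hi => ?_
          split_ifs with hiK
          · rfl
          · exact (hside i hi).2.2 hiK
      _ ≤ ∑ i ∈ S, g i := by
          refine Finset.sum_le_sum_of_subset_of_nonneg (fun i hi => ?_) fun i _ _ => hg0 i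
          obtain ⟨hi, hiK⟩ := Finset.mem_filter.1 hi
          exact (hS i).2 ⟨hiK, (hside i hi).2.1 hiK, (hside i hi).1⟩
  -- nonnegativity and the layer bound with `θ' = max θ 0`
  have hNS : 0 ≤ ∑ i ∈ S, g i := Finset.sum_nonneg fun i _ => hg0 i
  have hNL : 0 ≤ ∑ i ∈ K.filter (fun i => i.2.2 = 2) \ S, g i := Finset.sum_nonneg fun i _ => hg0 i
  have hDL : 0 ≤ ∑ vd ∈ VL, piv vd := Finset.sum_nonneg fun vd _ => hpiv0 vd
  have hlayer' : ∑ i ∈ K.filter (fun i => i.2.2 = 2) \ S, g i + ∑ vd ∈ VL, piv vd ≤ θ' * ∑ i ∈ S, g i :=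
    hlayer.trans (mul_le_mul_of_nonneg_right (le_max_left _ _) hNS)
  exact signedDomination_three_algebra hk hθ'0 hθ'1 hc.1 hcθ hNS hNL hDL hpen htr hS'S hlayer' hDc

/-! ## (SD) and (LOC) for `k = 2, 3` from the two layer hypotheses -/

/-- **Signed domination (SD) modulo the boundary layers** (registered helper of
`stub_cornerLocalSlope`): (LAYER₂) → (LAYER₃) → (SD) for `k = 2, 3` — the registered text of the
signed domination inequality `a · ∂cP ≤ ∂ρP + B · c · ∂cP` on the corner level band
(`cornerSignedDomination_two_of_layerTerms` and `cornerSignedDomination_three_of_layerTerms`). -/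
theorem cornerSignedDomination_of_layerTerms : (∀ k : ℕ, k = 2 → ∀ (m : ℕ) (F : Fin m → Quad (Set.univ : Set ℂ)), 0 < m → ∃ δ c₁ θ : ℝ, 0 < δ ∧ 0 < c₁ ∧ θ < 1 ∧ ∀ vlo vhi : ℝ, 0 < vlo → vlo < vhi → vhi < 1 → ∃ η₀ : ℝ, 0 < η₀ ∧ ∀ η ∈ Set.Ioo 0 η₀, ∀ ρ ∈ Set.Icc (1 - 2 * δ) 1, ∀ c ∈ Set.Icc (0 : ℝ) c₁, P k m F η ρ c ∈ Set.Icc vlo vhi → ∃ r r' : ℝ, 20 * η ≤ r ∧ r + 6 * η ≤ r' ∧ ∀ (K S : Finset (Site 2 × Fin 2 × Fin 3)), (↑K : Set (Site 2 × Fin 2 × Fin 3)) = coinWindow k (window m F η) → (∀ i, i ∈ S ↔ i ∈ K ∧ i.2.2 = 2 ∧ ∀ j : ℕ, 0 < j → j < k → ∀ (a : Fin m) (b : Fin 4), ∀ p ∈ (F a).side b, r ≤ dist ((η : ℂ) * squareLatticeEmbedding.z (fun l => (k : ℤ) * i.1 l + if l = i.2.1 then (j : ℤ) else 0)) p) → ∀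 VL : Finset (Site 2 × Fin 2), (∀ vd, vd ∈ VL ↔ (edgeOf vd ∈ window m F η ∧ ¬ ax k vd) ∧ ∃ x ∈ edgeOf vd, ∃ (a : Fin m) (b : Fin 4), ∃ p ∈ (F a).side b, dist ((η : ℂ) * squareLatticeEmbedding.z x) p < r') → ∑ i ∈ K.filter (fun i => i.2.2 = 2) \ S, (M k ρ c).real {ω | ω ∪ edgeOf '' {vd : Site 2 × Fin 2 | ax k vd ∧ tb k vd = i.1 ∧ vd.2 = i.2.1} ∈ Aloc m F η ∧ ω \ edgeOf '' {vd : Site 2 × Fin 2 | ax k vd ∧ tb k vd = i.1 ∧ vd.2 = i.2.1} ∉ Aloc m F η} + ∑ vd ∈ VL, (M k ρ c).real {ω | IsPivotal (Aloc m F η) (edgeOf vd) ω} ≤ θ * ∑ i ∈ S, (M k ρ c).real {ω | ω ∪ edgeOf '' {vd : Site 2 × Fin 2 | ax k vd ∧ tb k vd = i.1 ∧ vd.2 = i.2.1} ∈ Aloc m F η ∧ ω \ edgeOf '' {vd : Site 2 × Fin 2 | ax k vd ∧ tb k vd = i.1 ∧ vd.2 = i.2.1} ∉ Aloc m F η}) →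 (∀ k : ℕ, k = 3 → ∀ (m : ℕ) (F : Fin m → Quad (Set.univ : Set ℂ)), 0 < m → ∃ δ c₁ θ : ℝ, 0 < δ ∧ 0 < c₁ ∧ θ < 1 ∧ ∀ vlo vhi : ℝ, 0 < vlo → vlo < vhi → vhi < 1 → ∃ η₀ : ℝ, 0 < η₀ ∧ ∀ η ∈ Set.Ioo 0 η₀, ∀ ρ ∈ Set.Icc (1 - 2 * δ) 1, ∀ c ∈ Set.Icc (0 : ℝ) c₁, P k m F η ρ c ∈ Set.Icc vlo vhi → ∃ r r' : ℝ, 20 * η ≤ r ∧ r + 9 * η ≤ r' ∧ ∀ (K S : Finset (Site 2 × Fin 2 × Fin 3)), (↑K : Set (Site 2 × Fin 2 × Fin 3)) = coinWindow k (window m F η) → (∀ i, i ∈ S ↔ i ∈ K ∧ i.2.2 = 2 ∧ ∀ j : ℕ, 0 < j → j < k → ∀ (a : Fin m) (b : Fin 4), ∀ p ∈ (F a).side b, r ≤ dist ((η : ℂ) * squareLatticeEmbedding.z (fun l => (k : ℤ) * i.1 l + if l = i.2.1 then (j : ℤ) else 0)) p) → ∀ VL : Finset (Site 2 × Fin 2),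 (∀ vd, vd ∈ VL ↔ (edgeOf vd ∈ window m F η ∧ ¬ ax k vd) ∧ ∃ x ∈ edgeOf vd, ∃ (a : Fin m) (b : Fin 4), ∃ p ∈ (F a).side b, dist ((η : ℂ) * squareLatticeEmbedding.z x) p < r') → ∑ i ∈ K.filter (fun i => i.2.2 = 2) \ S, (M k ρ c).real {ω | ω ∪ edgeOf '' {vd : Site 2 × Fin 2 | ax k vd ∧ tb k vd = i.1 ∧ vd.2 = i.2.1} ∈ Aloc m F η ∧ ω \ edgeOf '' {vd : Site 2 × Fin 2 | ax k vd ∧ tb k vd = i.1 ∧ vd.2 = i.2.1} ∉ Aloc m F η} + ∑ vd ∈ VL, (M k ρ c).real {ω | IsPivotal (Aloc m F η) (edgeOf vd) ω} ≤ θ * ∑ i ∈ S, (M k ρ c).real {ω | ω ∪ edgeOf '' {vd : Site 2 × Fin 2 | ax k vd ∧ tb k vd = i.1 ∧ vd.2 = i.2.1} ∈ Aloc m F η ∧ ω \ edgeOf '' {vd : Site 2 × Fin 2 | ax k vd ∧ tb k vd = i.1 ∧ vd.2 = i.2.1} ∉ Aloc m F η}) → ∀ k : ℕ, k = 2 ∨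 k = 3 → ∀ (m : ℕ) (F : Fin m → Quad (Set.univ : Set ℂ)), 0 < m → ∃ δ a B c₁ : ℝ, 0 < δ ∧ 0 < a ∧ 0 < c₁ ∧ ∀ vlo vhi : ℝ, 0 < vlo → vlo < vhi → vhi < 1 → ∃ η₀ : ℝ, 0 < η₀ ∧ ∀ η ∈ Set.Ioo 0 η₀, ∀ ρ ∈ Set.Icc (1 - 2 * δ) 1, ∀ c ∈ Set.Icc (0 : ℝ) c₁, P k m F η ρ c ∈ Set.Icc vlo vhi → a * Dc k m F η (ρ, c) ≤ Dρ k m F η (ρ, c) + B * c * Dc k m F η (ρ, c) := by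
  intro hL2 hL3 k hk m F hm
  rcases hk with rfl | rfl
  · exact cornerSignedDomination_two_of_layerTerms hL2 2 rfl m F hm
  · exact cornerSignedDomination_three_of_layerTerms hL3 3 rfl m F hm

/-- **The local corner slope bound (LOC) modulo the boundary layers** (registered helper of
`stub_cornerLocalSlope`): (LAYER₂) → (LAYER₃) → the statement of `stub_cornerLocalSlope` verbatim
(`|∂cP| ≤ C |∂ρP|` on the corner level band for `k = 2, 3`), by `cornerSignedDomination_of_layerTerms`
and `cornerLocalSlope_of_signedDomination`.  The two layer hypotheses (half-plane three-arm
summability of the boundary layer near the quad sides, for `k = 2` and `k = 3`) are the final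
residue of the stub. -/
theorem cornerLocalSlope_of_layerTerms : (∀ k : ℕ, k = 2 → ∀ (m : ℕ) (F : Fin m → Quad (Set.univ : Set ℂ)), 0 < m → ∃ δ c₁ θ : ℝ, 0 < δ ∧ 0 < c₁ ∧ θ < 1 ∧ ∀ vlo vhi : ℝ, 0 < vlo → vlo < vhi → vhi < 1 → ∃ η₀ : ℝ, 0 < η₀ ∧ ∀ η ∈ Set.Ioo 0 η₀, ∀ ρ ∈ Set.Icc (1 - 2 * δ) 1, ∀ c ∈ Set.Icc (0 : ℝ) c₁, P k m F η ρ c ∈ Set.Icc vlo vhi → ∃ r r' : ℝ, 20 * η ≤ r ∧ r + 6 * η ≤ r' ∧ ∀ (K S : Finset (Site 2 × Fin 2 × Fin 3)), (↑K : Set (Site 2 × Fin 2 × Fin 3)) = coinWindow k (window m F η) → (∀ i, i ∈ S ↔ i ∈ K ∧ i.2.2 = 2 ∧ ∀ j : ℕ, 0 < j → j < k → ∀ (a : Fin m) (b : Fin 4), ∀ p ∈ (F a).side b, r ≤ dist ((η : ℂ) * squareLatticeEmbedding.z (fun l => (k : ℤ) * i.1 l + if l = i.2.1 then (j : ℤ)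 else 0)) p) → ∀ VL : Finset (Site 2 × Fin 2), (∀ vd, vd ∈ VL ↔ (edgeOf vd ∈ window m F η ∧ ¬ ax k vd) ∧ ∃ x ∈ edgeOf vd, ∃ (a : Fin m) (b : Fin 4), ∃ p ∈ (F a).side b, dist ((η : ℂ) * squareLatticeEmbedding.z x) p < r') → ∑ i ∈ K.filter (fun i => i.2.2 = 2) \ S, (M k ρ c).real {ω | ω ∪ edgeOf '' {vd : Site 2 × Fin 2 | ax k vd ∧ tb k vd = i.1 ∧ vd.2 = i.2.1} ∈ Aloc m F η ∧ ω \ edgeOf '' {vd : Site 2 × Fin 2 | ax k vd ∧ tb k vd = i.1 ∧ vd.2 = i.2.1} ∉ Aloc m F η} + ∑ vd ∈ VL, (M k ρ c).real {ω | IsPivotal (Aloc m F η) (edgeOf vd) ω} ≤ θ * ∑ i ∈ S, (M k ρ c).real {ω | ω ∪ edgeOf '' {vd : Site 2 × Fin 2 | ax k vd ∧ tb k vd = i.1 ∧ vd.2 = i.2.1} ∈ Aloc m F η ∧ ω \ edgeOf '' {vd : Site 2 × Fin 2 | ax k vd ∧ tb k vd = i.1 ∧ vd.2 = i.2.1} ∉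 Aloc m F η}) → (∀ k : ℕ, k = 3 → ∀ (m : ℕ) (F : Fin m → Quad (Set.univ : Set ℂ)), 0 < m → ∃ δ c₁ θ : ℝ, 0 < δ ∧ 0 < c₁ ∧ θ < 1 ∧ ∀ vlo vhi : ℝ, 0 < vlo → vlo < vhi → vhi < 1 → ∃ η₀ : ℝ, 0 < η₀ ∧ ∀ η ∈ Set.Ioo 0 η₀, ∀ ρ ∈ Set.Icc (1 - 2 * δ) 1, ∀ c ∈ Set.Icc (0 : ℝ) c₁, P k m F η ρ c ∈ Set.Icc vlo vhi → ∃ r r' : ℝ, 20 * η ≤ r ∧ r + 9 * η ≤ r' ∧ ∀ (K S : Finset (Site 2 × Fin 2 × Fin 3)), (↑K : Set (Site 2 × Fin 2 × Fin 3)) = coinWindow k (window m F η) → (∀ i, i ∈ S ↔ i ∈ K ∧ i.2.2 = 2 ∧ ∀ j : ℕ, 0 < j → j < k → ∀ (a : Fin m) (b : Fin 4), ∀ p ∈ (F a).side b, r ≤ dist ((η : ℂ) * squareLatticeEmbedding.z (fun l => (k : ℤ) * i.1 l + if l = i.2.1 then (j : ℤ) else 0)) p) → ∀ VL : Finset (Site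 2 × Fin 2), (∀ vd, vd ∈ VL ↔ (edgeOf vd ∈ window m F η ∧ ¬ ax k vd) ∧ ∃ x ∈ edgeOf vd, ∃ (a : Fin m) (b : Fin 4), ∃ p ∈ (F a).side b, dist ((η : ℂ) * squareLatticeEmbedding.z x) p < r') → ∑ i ∈ K.filter (fun i => i.2.2 = 2) \ S, (M k ρ c).real {ω | ω ∪ edgeOf '' {vd : Site 2 × Fin 2 | ax k vd ∧ tb k vd = i.1 ∧ vd.2 = i.2.1} ∈ Aloc m F η ∧ ω \ edgeOf '' {vd : Site 2 × Fin 2 | ax k vd ∧ tb k vd = i.1 ∧ vd.2 = i.2.1} ∉ Aloc m F η} + ∑ vd ∈ VL, (M k ρ c).real {ω | IsPivotal (Aloc m F η) (edgeOf vd) ω} ≤ θ * ∑ i ∈ S, (M k ρ c).real {ω | ω ∪ edgeOf '' {vd : Site 2 × Fin 2 | ax k vd ∧ tb k vd = i.1 ∧ vd.2 = i.2.1} ∈ Aloc m F η ∧ ω \ edgeOf '' {vd : Site 2 × Fin 2 | ax k vd ∧ tb k vd = i.1 ∧ vd.2 = i.2.1} ∉ Aloc m F η}) → ∀ k : ℕ,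 k = 2 ∨ k = 3 → ∀ (m : ℕ) (F : Fin m → Quad (Set.univ : Set ℂ)), 0 < m → ∃ δ c₀ : ℝ, 0 < δ ∧ 0 < c₀ ∧ ∀ vlo vhi : ℝ, 0 < vlo → vlo < vhi → vhi < 1 → ∃ C η₁ : ℝ, 0 < η₁ ∧ ∀ η ∈ Set.Ioo 0 η₁, ∀ ρ ∈ Set.Icc (1 - 2 * δ) 1, ∀ c ∈ Set.Icc (0 : ℝ) c₀, P k m F η ρ c ∈ Set.Icc vlo vhi → |Dc k m F η (ρ, c)| ≤ C * |Dρ k m F η (ρ, c)| := by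
  intro hL2 hL3 k hk m F hm
  exact cornerLocalSlope_of_signedDomination k m F (cornerSignedDomination_of_layerTerms hL2 hL3 k hk m F hm)

end Summit.CriticalPhenomena.CardyFormulaZ2.Theorems.CardySelfRefinement

end
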